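import Summits.HodgeConjecture.HodgeCM.PerL34.LocalFactors.SchrodingerLevi_1

/-! PORT of `HodgeCM/PerL34/LocalFactors/SchrodingerLevi.lean` (HodgeCMPerL run 82) — part 2: continuation of `Summits.HodgeConjecture.HodgeCM.PerL34.LocalFactors.SchrodingerLevi_1` (split at a top-level declaration boundary by port_pkg.py; scope re-opened below; declarations unchanged). -/

-- port_pkg: scope re-opened for this part (file-level context, then the namespace/section stack open at the cut)
set_option autoImplicit false
noncomputable section
open MeasureTheory MeasureTheory.Measure Set Complex
open scoped ENNReal NNReal Pointwise InnerProductSpace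
namespace HodgeCM
namespace PerL34
namespace LocalFactors
namespace SchrodingerLevi
open DilationModel
section Levi
variable {G : Type*} [CommGroup G] {X : Type*} [AddCommGroup X] [DistribMulAction G X]
  [TopologicalSpace X] [IsTopologicalAddGroup X] [LocallyCompactSpace X] [ContinuousConstSMul G X]
  [MeasurableSpace X] [BorelSpace X] (μ : Measure X) [μ.IsAddHaarMeasure] [μ.Regular]

/-- `dilationRep μ ν g = ν(g) • dilationRep μ 1 g` pointwise: the character is a scalar factor -/
theorem dilationRep_apply_eq_smul (ν : G →* Circle) (g : G) (f : Lp ℂ 2 μ) :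
    dilationRep μ ν g f = (ν g : ℂ) • dilationRep μ 1 g f := by
  apply Lp.ext
  refine (coeFn_dilationRep μ ν g f).trans (Filter.EventuallyEq.trans ?_ (Lp.coeFn_smul _ _).symm)
  filter_upwards [coeFn_dilationRep μ 1 g f] with u hu
  rw [Pi.smul_apply, hu, smul_eq_mul, ← mul_assoc]
  congr 1
  simp only [weight, MonoidHom.one_apply, Circle.coe_one, one_mul]

/-- **`T_g τ_x = τ_{g⁻¹ • x} T_g`** — the dilation conjugates a translation to a translation -/
theorem dilationRep_translate (ν : G →* Circle) (g : G) (x : X) (f : Lp ℂ 2 μ) :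
    dilationRep μ ν g (translate μ x f) = translate μ (g⁻¹ • x) (dilationRep μ ν g f) := by
  apply Lp.ext
  refine (coeFn_dilationRep μ ν g _).trans (Filter.EventuallyEq.trans ?_ (coeFn_translate μ _ _).symm)
  have h1 := (quasiMeasurePreserving_smul' μ g).ae_eq_comp (coeFn_translate μ x f)
  have h2 := (measurePreserving_add_right μ (g⁻¹ • x)).quasiMeasurePreserving.ae_eq_comp
    (coeFn_dilationRep μ ν g f)
  filter_upwards [h1, h2] with u hu1 hu2
  simp only [Function.comp_apply] at hu1 hu2
  rw [hu1, hu2, smul_add, smul_inv_smul]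

/-- **`T_g M_c = M_{c ∘ (g • ·)} T_g`** — the dilation conjugates a modulation to a modulation -/
theorem dilationRep_modulate (ν : G →* Circle) (g : G) (c : C(X, Circle)) (f : Lp ℂ 2 μ) :
    dilationRep μ ν g (modulate μ c f) = modulate μ (c.comp (smulMap g)) (dilationRep μ ν g f) := by
  apply Lp.ext
  refine (coeFn_dilationRep μ ν g _).trans (Filter.EventuallyEq.trans ?_ (coeFn_modulate μ _ _).symm)
  have h1 := (quasiMeasurePreserving_smul' μ g).ae_eq_comp (coeFn_modulate μ c f)
  filter_upwards [h1, coeFn_dilationRep μ ν g f] with u hu1 hu2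
  simp only [Function.comp_apply] at hu1
  rw [hu1, hu2, ContinuousMap.comp_apply, smulMap_apply]
  ring

end Levi

/-! ## §3  The headline: a Weil representation on the Siegel Levi IS the dilation representation, up to a unique
unitary character -/

section Headline

variable {G : Type*} [CommGroup G] {X : Type*} [AddCommGroup X] [DistribMulAction G X]
  [TopologicalSpace X] [IsTopologicalAddGroup X] [LocallyCompactSpace X] [ContinuousConstSMul G X]
  [MeasurableSpace X] [BorelSpace X] (μ : Measure X) [μ.IsAddHaarMeasure] [μ.Regular]

/-- **The Schrödinger system** of a family `𝓜 ⊆ C(X, S¹)` of multipliers: all translations `τ_x`, `x ∈ X`, and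
the modulations `M_c`, `c ∈ 𝓜`.  Print ([MVW ch. 2, I.3–I.4, II.6]): `𝓜` = the unitary characters
`u ↦ ψ(⟨u, ξ⟩)`, `ξ ∈ X*` — then this is the Schrödinger representation `ρ_ψ` of the Heisenberg group `H(X ⊕ X*)`
on `L²(X)`, up to its central scalars. -/
def schrodingerSystem (𝓜 : Set C(X, Circle)) : Set (Lp ℂ 2 μ → Lp ℂ 2 μ) :=
  Set.range (fun x : X => ⇑(translate μ x)) ∪ (fun c : C(X, Circle) => ⇑(modulate μ c)) '' 𝓜

omit [IsTopologicalAddGroup X] [μ.Regular] in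
/-- `L²(X, μ) ≠ 0`: the indicator of the interior of a compact neighbourhood of `0` is a non-zero vector -/
theorem exists_ne_zero : ∃ f : Lp ℂ 2 μ, f ≠ 0 := by
  obtain ⟨K, hK, hK0⟩ := exists_compact_mem_nhds (0 : X)
  have hpos : μ (interior K) ≠ 0 :=
    (isOpen_interior.measure_pos μ ⟨0, mem_interior_iff_mem_nhds.2 hK0⟩).ne'
  have htop : μ (interior K) ≠ ⊤ := ((measure_mono interior_subset).trans_lt hK.measure_lt_top).ne
  refine ⟨indicatorConstLp 2 isOpen_interior.measurableSet htop (1 : ℂ), ?_⟩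
  rw [← norm_ne_zero_iff, norm_indicatorConstLp two_ne_zero ENNReal.ofNat_ne_top, norm_one, one_mul]
  exact (Real.rpow_pos_of_pos (ENNReal.toReal_pos hpos htop) _).ne'

omit [IsTopologicalAddGroup X] [μ.Regular] in
/-- (Ported verbatim from the HodgeCMPerL package; no docstring in the source.) -/
theorem nontrivial_Lp : Nontrivial (Lp ℂ 2 μ) :=
  let ⟨f, hf⟩ := exists_ne_zero μ
  ⟨⟨f, 0, hf⟩⟩

/-- the character of a dilation representation is determined by the representation -/
theorem dilationRep_injective : Function.Injective (dilationRep μ : (G →* Circle) → _) := by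
  intro ν ν' h
  ext g
  obtain ⟨f, hf⟩ := exists_ne_zero μ
  have hne : dilationRep μ 1 g f ≠ 0 := (map_ne_zero_iff _ (dilationRep μ 1 g).injective).2 hf
  have key : dilationRep μ ν g f = dilationRep μ ν' g f := by rw [h]
  rw [dilationRep_apply_eq_smul μ ν, dilationRep_apply_eq_smul μ ν'] at key
  exact congrArg _ (Circle.ext (smul_left_injective ℂ hne key))

/-- **Rigidity of the split local model — the Weil representation on the Siegel Levi.**
Let `ω : G →* U(L²(X, μ))` be a unitary representation normalising the Schrödinger system of `𝓜` EXACTLY AS THE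
LEVI ELEMENT DOES: `ω(g) τ_x = τ_{g⁻¹ • x} ω(g)` and `ω(g) M_c = M_{c ∘ (g • ·)} ω(g)` for `c ∈ 𝓜` — the defining
property [MVW ch. 2, II.1 (A)] `M ρ_ψ(h) M⁻¹ = ρ_ψ(gh)` of the Weil representation, restricted to the Levi of the
polarisation `X ⊕ X*`.  If the Schrödinger system of `𝓜` has scalar commutant (Stone–von Neumann irreducibility,
[MVW ch. 2, I.2] — the hypothesis `hirr`), then `ω` IS the dilation representation `dilationRep μ ν`,
`(ω(g) f)(u) = ν(g) δ(g)^{1/2} f(g • u)`, for a unitary character `ν : G →* S¹`.  PerL v5 tex ll. 610–611: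
"`(ω(y)φ)(x) = |y|^{3/2} φ(yx)` up to a unitary character" — DERIVED, with [MVW II.6]'s `|det_X a|^{1/2}`
(`= δ^{1/2}`, `distribHaarChar`) forced by unitarity. -/
theorem weilLevi_eq_dilationRep (𝓜 : Set C(X, Circle))
    (hirr : HasScalarCommutant (Lp ℂ 2 μ) (schrodingerSystem μ 𝓜))
    (ω : G →* (Lp ℂ 2 μ ≃ₗᵢ[ℂ] Lp ℂ 2 μ))
    (hτ : ∀ (g : G) (x : X) (f : Lp ℂ 2 μ), ω g (translate μ x f) = translate μ (g⁻¹ • x) (ω g f))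
    (hM : ∀ (g : G), ∀ c ∈ 𝓜, ∀ f : Lp ℂ 2 μ,
      ω g (modulate μ c f) = modulate μ (c.comp (smulMap g)) (ω g f)) :
    ∃ ν : G →* Circle, ω = dilationRep μ ν := by
  haveI : Nontrivial (Lp ℂ 2 μ) := nontrivial_Lp μ
  obtain ⟨ν, hν⟩ := exists_character_of_conj_eq (schrodingerSystem μ 𝓜) hirr (dilationRep μ 1) ω
    (fun g S hS => by
      rcases hS with ⟨x, rfl⟩ | ⟨c, hc, rfl⟩
      · exact ⟨⇑(translate μ (g⁻¹ • x)), fun v => dilationRep_translate μ 1 g x v, fun v => hτ g x v⟩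
      · exact ⟨⇑(modulate μ (c.comp (smulMap g))), fun v => dilationRep_modulate μ 1 g c v,
          fun v => hM g c hc v⟩)
  refine ⟨ν, MonoidHom.ext fun g => LinearIsometryEquiv.ext fun f => ?_⟩
  rw [hν, dilationRep_apply_eq_smul μ ν g f]

/-- **… and the unitary character is UNIQUE** (PerL's "up to a unitary character", sharpened). -/
theorem weilLevi_existsUnique (𝓜 : Set C(X, Circle))
    (hirr : HasScalarCommutant (Lp ℂ 2 μ) (schrodingerSystem μ 𝓜))
    (ω : G →* (Lp ℂ 2 μ ≃ₗᵢ[ℂ] Lp ℂ 2 μ))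
    (hτ : ∀ (g : G) (x : X) (f : Lp ℂ 2 μ), ω g (translate μ x f) = translate μ (g⁻¹ • x) (ω g f))
    (hM : ∀ (g : G), ∀ c ∈ 𝓜, ∀ f : Lp ℂ 2 μ,
      ω g (modulate μ c f) = modulate μ (c.comp (smulMap g)) (ω g f)) :
    ∃! ν : G →* Circle, ω = dilationRep μ ν := by
  obtain ⟨ν, hν⟩ := weilLevi_eq_dilationRep μ 𝓜 hirr ω hτ hM
  exact ⟨ν, hν, fun ν' hν' => dilationRep_injective μ (hν'.symm.trans hν)⟩

/-- **D4 (b) in the intertwiner currency of `DilationIntertwiner.coeff_eq_of_factor_intertwiner`** (pv07-g2,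
binder `hU : ∀ y, U (ω_v y φ_v) = dilationRep μV ν (t y) (U φ_v)`): for a Weil representation on the Levi realised
on `L²(X, μ)` the intertwiner is the IDENTITY (`U = LinearIsometry.id`, `t = id`), for EVERY vector. -/
theorem weilLevi_intertwiner (𝓜 : Set C(X, Circle))
    (hirr : HasScalarCommutant (Lp ℂ 2 μ) (schrodingerSystem μ 𝓜))
    (ω : G →* (Lp ℂ 2 μ ≃ₗᵢ[ℂ] Lp ℂ 2 μ))
    (hτ : ∀ (g : G) (x : X) (f : Lp ℂ 2 μ), ω g (translate μ x f) = translate μ (g⁻¹ • x) (ω g f))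
    (hM : ∀ (g : G), ∀ c ∈ 𝓜, ∀ f : Lp ℂ 2 μ,
      ω g (modulate μ c f) = modulate μ (c.comp (smulMap g)) (ω g f)) :
    ∃ ν : G →* Circle, ∀ (g : G) (f : Lp ℂ 2 μ),
      (LinearIsometry.id : Lp ℂ 2 μ →ₗᵢ[ℂ] Lp ℂ 2 μ) (ω g f)
        = dilationRep μ ν g ((LinearIsometry.id : Lp ℂ 2 μ →ₗᵢ[ℂ] Lp ℂ 2 μ) f) := by
  obtain ⟨ν, hν⟩ := weilLevi_eq_dilationRep μ 𝓜 hirr ω hτ hM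
  exact ⟨ν, fun g f => by rw [LinearIsometry.id_apply, LinearIsometry.id_apply, hν]⟩

/-- **D4 for every indicator vector** — PerL v5 tex l. 613 / ll. 621–623
"`m(y) = ⟨ω_v(y)φ_v, φ_v⟩ = vol(D ∩ y⁻¹D)·|y|^{3/2}`" (up to the unitary character) for the ACTUAL `ω`, not a model of
it: `⟪1_A, ω(g) 1_A⟫ = ν(g) δ(g)^{1/2} vol(A ∩ g⁻¹A)` for every measurable `A` of finite measure (the landed
`DilationModel.inner_indicator_dilationRep` transported along `weilLevi_eq_dilationRep`). -/
theorem weilLevi_inner_indicator (𝓜 : Set C(X, Circle))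
    (hirr : HasScalarCommutant (Lp ℂ 2 μ) (schrodingerSystem μ 𝓜))
    (ω : G →* (Lp ℂ 2 μ ≃ₗᵢ[ℂ] Lp ℂ 2 μ))
    (hτ : ∀ (g : G) (x : X) (f : Lp ℂ 2 μ), ω g (translate μ x f) = translate μ (g⁻¹ • x) (ω g f))
    (hM : ∀ (g : G), ∀ c ∈ 𝓜, ∀ f : Lp ℂ 2 μ,
      ω g (modulate μ c f) = modulate μ (c.comp (smulMap g)) (ω g f)) :
    ∃ ν : G →* Circle, ∀ (g : G) {A : Set X} (hA : MeasurableSet A) (hμA : μ A ≠ ⊤),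
      ⟪indicatorConstLp 2 hA hμA (1 : ℂ), ω g (indicatorConstLp 2 hA hμA (1 : ℂ))⟫_ℂ
        = weight X ν g * (μ.real (A ∩ (fun x => g • x) ⁻¹' A) : ℂ) := by
  obtain ⟨ν, hν⟩ := weilLevi_eq_dilationRep μ 𝓜 hirr ω hτ hM
  exact ⟨ν, fun g A hA hμA => by rw [hν]; exact inner_indicator_dilationRep μ ν g hA hμA⟩

end Headline

/-! ## §4  PerL's instance: `G = Fˣ`, `X = Fⁿ` (`F = L_{0,v}`, `n = 3`) -/

section SplitPlace

variable {F : Type} [NormedField F] [IsUltrametricDist F] [ProperSpace F] {n : ℕ}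
  [MeasurableSpace (Fin n → F)] [BorelSpace (Fin n → F)] (μV : Measure (Fin n → F)) [μV.IsAddHaarMeasure]

/-- **PerL Lemma 4.2(b), tex ll. 610–611, at a split place — the operator is FORCED.**  A unitary representation
`ω` of `U(W_i)(L_{0,v}) = Fˣ` on `L²(Fⁿ)` normalising the Schrödinger system as the Levi `y ↦ diag(y, y⁻¹)` does
(`ω(y) τ_x = τ_{y⁻¹x} ω(y)`, `ω(y) M_c = M_{c(y·)} ω(y)`), the system being irreducible (Stone–von Neumann), is
`φ ↦ ν(y)|y|^{n/2}φ(y·)` for a unique unitary character `ν` of `Fˣ`. -/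
theorem splitPlace_weilLevi (𝓜 : Set C(Fin n → F, Circle))
    (hirr : HasScalarCommutant (Lp ℂ 2 μV) (schrodingerSystem μV 𝓜))
    (ω : Fˣ →* (Lp ℂ 2 μV ≃ₗᵢ[ℂ] Lp ℂ 2 μV))
    (hτ : ∀ (y : Fˣ) (x : Fin n → F) (f : Lp ℂ 2 μV),
      ω y (translate μV x f) = translate μV (y⁻¹ • x) (ω y f))
    (hM : ∀ (y : Fˣ), ∀ c ∈ 𝓜, ∀ f : Lp ℂ 2 μV,
      ω y (modulate μV c f) = modulate μV (c.comp (smulMap y)) (ω y f)) :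
    ∃! ν : Fˣ →* Circle, ω = dilationRep μV ν :=
  weilLevi_existsUnique μV 𝓜 hirr ω hτ hM

end SplitPlace

end SchrodingerLevi
end LocalFactors
end PerL34
end HodgeCM

-- port_pkg: scope closed for this part
end
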